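import Summits.Schanuel.Schanuel.Theorems.RootDecomp1BTwoRadical05

/-!
# RootDecomp1BProductCell — lens 4, generation 46 «PRODUCT CELL: TWO INDEPENDENT LIOUVILLE COORDINATES VIA THE QUANTITATIVE STOREY-ONE CELL» (CLAIM L2339, PRICE + CHECKLIST B-g46 L2340, NODE L2399 / REQUEST L2400, critic VERDICT L2407: CLEARED — THEOREM ×1 (K1 twoRadical_lower, the composable quantitative engine) + ONE CELL «RATE-MATCHED PRODUCT 𝒜_W × ℬ_W» (K2 algebraicIndependent_product + cells); RULE B-R33; PORT GO) — part 1 (RootDecomp1BProductCell01): §1 Lipschitz constant, §2 root avoidance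

(lens-4 g46 HOME kernel K = HOME/decomp-schanuel-lens-4/g46/ProductCell.lean d6cd9943…, 1931 l, ONE import …RootDecomp1BTwoRadical05; P/C + NODE-g46.md 601195d2…. Port by census-1 gen 20 as `RootDecomp1BProductCell01–08` from the census CAP EDITION ProductCell.capped.lean (K2 `algebraicIndependent_product` is ONE 398-line declaration block > the 400-line file cap: its step (3) «thrP(N) ≤ exp(c_T q⁴)» — four exponential bounds, context-free — is extracted as the public lemma `thr_le_exp_quartic` in §3c with the local abbreviations passed as variables and the defining equation of c_T as a hypothesis; K2's STATEMENT byte-identical, all 87 K decl signatures identical, +1 decl; farm rc 0 · 0/0/0 · axioms std on K2): 01 = §1 Lipschitz (`FrelC`, `lam`, `lipschitz_Frel₂_explicit`) + §2 root avoidance (`fibreSum_ne_zero`); 02 = §3 K1 `thr`, `bigTheta`, `thrP`, **`twoRadical_lower`**; 03 = §3b outer upper half (`norm_normForm_le`, `normForm_len_le`); 04 = §3c `thr_le`, `thr_le_exp_quartic` (cap lemma) + §4 classes `UltraLiouvilleSW` / `TowerLiouville` («[class] definition» tags) + `thr_nonneg` + §5 prelude `thetaS`; 05 = §5 K2 **`algebraicIndependent_product`**;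 06 = §6 law `sw`, members `ultraLiouvilleSW_rhoU` (tree rhoU), `gT`/`vT`/`tTerm`/`rhoT`/`tNum`/`tRat`, `towerLiouville_rhoT`; 07 = §7 cells `algebraicIndependent_eight_of_pos`, `eight_le_polarDeg_one_pair`, `six_le_polarDeg_one_pair`, `schanuel_body_one_pair`, `six_le_polarDeg_pair`, `four_le_polarDeg_pair`, `schanuel_body_pair`, named pair (ρ_U, ρ_T) hyp-free; 08 = §8 `E₅`, `thrP_le_exp`, `transcMeasure_thetaS`, `transcMeasure_rhoU`. PORT EDITS (VERDICT L2407 (a)–(d) + the cap edition): linter option dropped; 26 one-line docstrings added; class tags in the census wording; scoped heartbeats kept `… in` (1600000 ×2, 800000 ×1 as in K); per-part private helper copies; statements and proofs otherwise verbatim (no renames). `--supports stmt-Schanuel-24622`; no census credit carried; rung 0 — nothing here proves Schanuel; no ∀-item moves.)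
-/

/-!
# RootDecomp1BProductCell — lens 4, generation 46 «PRODUCT CELL: TWO INDEPENDENT LIOUVILLE COORDINATES VIA THE QUANTITATIVE STOREY-ONE CELL» (lane B-R32 (iii) / L2287 (v); CLAIM L2339)

HOME kernel K (lens-4 g46). Imports the tree port `RootDecomp1BTwoRadical05` ONLY (g44b's two-radical descent:
`radMat₂`, `det_radMat₂_ne_zero`, `det_eq_eigen_mul₂`, `Cf₂`, `Frel₂`, `eigen_eq_Frel₂`, `twoRadical_clash`, …, and through
it `RootDecomp1BRadicalDescent06` (`UltraLiouville`, `DExpMeasure`, `rhoU`, `uTow`, …) and `RootDecomp1BFactDischarge01`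
(`lwMeasure_holds`)). No ledger writes; rung 0 — nothing here proves Schanuel; no `∀`-item of the route moves.

THE LEVER. g44b's storey-one cell says: a relation `P(e^{σ}, e^{iσ}, σ, e, e^{i}) = 0` is impossible for `σ`
ultra-Liouville. §3 below makes it QUANTITATIVE: at every admissible scale `q = den r` of `σ` (threshold `thr P`
EXPLICIT in `deg P`, `mvlen P`) one has the LOWER BOUND `‖P(θ_σ)‖ ≥ exp(−exp((q²)^{A₀+2}))`. A quantitative cell is
COMPOSABLE: §5 descends a second, UNRELATED Liouville coordinate `ρ` over the TRANSCENDENTAL base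
`θ_σ = (e^{σ}, e^{iσ}, σ, e, e^{i})` exactly as g44b descends over `(e, e^{i})` — σ's structure BUILDS the bound, ρ's is
SPENT against it; no common denominator, no joint condition: the theorem holds on a PRODUCT class `𝒜_W × ℬ_W`.

CONTENTS. §1 explicit Lipschitz constant by Cauchy's estimate (`FrelC`, `lipschitz_Frel₂_explicit`); §2 root avoidance of
the fibre sums by the rational-root bound (`fibreSum_ne_zero`); §3 the QUANTITATIVE KERNEL `twoRadical_lower`;
§4 [class] `UltraLiouvilleSW W` (short waits) and `TowerLiouville W`; §5 THE PRODUCT KERNEL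
`algebraicIndependent_product`; §6 members (`ultraLiouvilleSW_rhoU`, `rhoT`, `towerLiouville_rhoT`); §7 cells
(`eight_le_polarDeg_one_pair`, `six_le_polarDeg_pair`, the Schanuel-instance bodies, the named pair `(ρ_U, ρ_T)`);
§8 the CLOSED-FORM COROLLARY of §3: a transcendence measure `exp(−E₅(C·(deg P + mvlen P)))` for `θ_σ`,
`σ ∈ UltraLiouvilleSW sw` (`transcMeasure_thetaS`), hypothesis-free at `ρ_U` (`transcMeasure_rhoU`).
-/

noncomputable section

open Complex

namespace Summit.Schanuel.Schanuel.Theorems.RootDecomp1BProductCell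

open MvPolynomial
open Summit.Schanuel.Schanuel.Theorems.RootDecomp1KHyper (mvlen mvlen_nonneg one_le_mvlen abs_coeff_le_mvlen)
open RootDecomp1BRadicalDescent (resFin DExpMeasure UltraLiouville exists_int_relation norm_mvaeval_le_mvlen
  totalDegree_det_le mvlen_det_le adjugate_bounds)
open RootDecomp1BTwoRadical (sX₃ sX₃_apply eq_of_parts₃ Cf₂ Frel₂ Frel₂_eq_aeval radMat₂ det_radMat₂_ne_zero
  det_eq_eigen_mul₂ eigen_eq_Frel₂ mvlen_radMat₂_le totalDegree_radMat₂_le mvlen_Cf₂_le twoRadical_clash)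

variable {n : ℕ}

/-! ## §1 The explicit Lipschitz constant (Cauchy's estimate) -/

section Lipschitz

variable (P : MvPolynomial (Fin (n + 3)) ℤ)

/-- `F(w) := P(e^{w y₀}, e^{w y₁}, w, θ)` for COMPLEX `w` — the entire extension of g44b's `Frel₂`. -/
def FrelC (θ : Fin n → ℂ) (y₀ y₁ : ℂ) (w : ℂ) : ℂ :=
  ∑ s ∈ P.support, ((P.coeff s : ℤ) : ℂ) *
    (cexp (w * y₀) ^ (s 0) * (cexp (w * y₁) ^ (s 1) * (w ^ (s 2) * ∏ j, θ j ^ (s j.succ.succ.succ))))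

/-- `Frel₂` is the restriction of `FrelC` to the real line (definitionally). -/
theorem Frel₂_eq_FrelC (θ : Fin n → ℂ) (y₀ y₁ : ℂ) (x : ℝ) :
    Frel₂ P θ y₀ y₁ x = FrelC P θ y₀ y₁ (x : ℂ) := rfl

/-- `FrelC` as an `MvPolynomial.aeval`. -/
theorem FrelC_eq_aeval (θ : Fin n → ℂ) (y₀ y₁ : ℂ) (w : ℂ) :
    FrelC P θ y₀ y₁ w =
      aeval (Fin.cons (cexp (w * y₀)) (Fin.cons (cexp (w * y₁)) (Fin.cons w θ)) : Fin (n + 3) → ℂ) P := by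
  unfold FrelC
  rw [MvPolynomial.aeval_def, MvPolynomial.eval₂_eq']
  refine Finset.sum_congr rfl fun s _ => ?_
  rw [Fin.prod_univ_succ, Fin.prod_univ_succ, Fin.prod_univ_succ]
  simp only [algebraMap_int_eq, eq_intCast, Fin.cons_zero, Fin.cons_succ]
  rfl

/-- `FrelC` is entire. -/
theorem differentiable_FrelC (θ : Fin n → ℂ) (y₀ y₁ : ℂ) : Differentiable ℂ (FrelC P θ y₀ y₁) := by
  show Differentiable ℂ (fun w => FrelC P θ y₀ y₁ w)
  unfold FrelC
  fun_prop

/-- The size constant `Λ(R) := Θ + e^{R‖y₀‖} + e^{R‖y₁‖} + R` bounding every coordinate of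
`(e^{wy₀}, e^{wy₁}, w, θ)` on `‖w‖ ≤ R`. -/
def lam (Θ : ℝ) (y₀ y₁ : ℂ) (R : ℝ) : ℝ := Θ + Real.exp (R * ‖y₀‖) + Real.exp (R * ‖y₁‖) + R

/-- `1 ≤ lam Θ y₀ y₁ R` for `Θ ≥ 1`, `R ≥ 0`. -/
theorem one_le_lam {Θ : ℝ} (hΘ : 1 ≤ Θ) (y₀ y₁ : ℂ) {R : ℝ} (hR : 0 ≤ R) : 1 ≤ lam Θ y₀ y₁ R := by
  unfold lam; linarith [Real.exp_pos (R * ‖y₀‖), Real.exp_pos (R * ‖y₁‖)]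

/-- `‖F(w)‖ ≤ mvlen P · Λ(R)^{deg P}` on `‖w‖ ≤ R`. -/
theorem norm_FrelC_le {θ : Fin n → ℂ} {Θ : ℝ} (hΘ : 1 ≤ Θ) (hθ : ∀ i, ‖θ i‖ ≤ Θ) (y₀ y₁ : ℂ)
    {R : ℝ} (hR : 0 ≤ R) {w : ℂ} (hw : ‖w‖ ≤ R) :
    ‖FrelC P θ y₀ y₁ w‖ ≤ (mvlen P : ℝ) * lam Θ y₀ y₁ R ^ P.totalDegree := by
  rw [FrelC_eq_aeval]
  have hΛ1 := one_le_lam hΘ y₀ y₁ hR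
  have he : ∀ y : ℂ, ‖cexp (w * y)‖ ≤ Real.exp (R * ‖y‖) := fun y => by
    rw [Complex.norm_exp]
    refine Real.exp_le_exp.2 ((Complex.re_le_norm _).trans ((norm_mul_le _ _).trans ?_))
    exact mul_le_mul_of_nonneg_right hw (norm_nonneg _)
  refine norm_mvaeval_le_mvlen P _ hΛ1 fun i => ?_
  have h0 := Real.exp_pos (R * ‖y₀‖)
  have h1 := Real.exp_pos (R * ‖y₁‖)
  refine Fin.cases ?_ (fun i => ?_) i
  · simp only [Fin.cons_zero]; unfold lam; linarith [he y₀, hθ, norm_nonneg w]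
  · rw [Fin.cons_succ]
    refine Fin.cases ?_ (fun i => ?_) i
    · simp only [Fin.cons_zero]; unfold lam; linarith [he y₁]
    · rw [Fin.cons_succ]
      refine Fin.cases ?_ (fun i => ?_) i
      · simp only [Fin.cons_zero]; unfold lam; linarith
      · rw [Fin.cons_succ]; unfold lam; linarith [hθ i]

/-- **EXPLICIT LIPSCHITZ CONSTANT** (Cauchy's estimate on the unit circles inside `‖w‖ ≤ |σ| + 2` + the mean-value
inequality on the ball `B(σ, 1)`): `‖F(x) − F(σ)‖ ≤ mvlen P · Λ(|σ|+2)^{deg P} · |x − σ|` for `|x − σ| < 1`. -/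
theorem lipschitz_Frel₂_explicit {θ : Fin n → ℂ} {Θ : ℝ} (hΘ : 1 ≤ Θ) (hθ : ∀ i, ‖θ i‖ ≤ Θ) (y₀ y₁ : ℂ)
    (σ : ℝ) {x : ℝ} (hx : |x - σ| < 1) :
    ‖Frel₂ P θ y₀ y₁ x - Frel₂ P θ y₀ y₁ σ‖ ≤
      ((mvlen P : ℝ) * lam Θ y₀ y₁ (|σ| + 2) ^ P.totalDegree) * |x - σ| := by
  set C : ℝ := (mvlen P : ℝ) * lam Θ y₀ y₁ (|σ| + 2) ^ P.totalDegree with hC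
  have hR : (0 : ℝ) ≤ |σ| + 2 := by positivity
  have hdiff := differentiable_FrelC P θ y₀ y₁
  -- derivative bound on the ball B(σ, 1) by Cauchy's estimate on the circle of radius 1
  have hderiv : ∀ z ∈ Metric.ball ((σ : ℝ) : ℂ) 1, ‖deriv (FrelC P θ y₀ y₁) z‖ ≤ C := by
    intro z hz
    have h := Complex.norm_deriv_le_of_forall_mem_sphere_norm_le (f := FrelC P θ y₀ y₁) (c := z) (R := 1)
      one_pos (hdiff.diffContOnCl) (C := C) (fun w hw => by
        refine norm_FrelC_le P hΘ hθ y₀ y₁ hR ?_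
        rw [Metric.mem_sphere, dist_eq_norm] at hw
        rw [Metric.mem_ball, dist_eq_norm] at hz
        have h1 : ‖w‖ ≤ ‖w - z‖ + ‖z - (σ : ℂ)‖ + ‖((σ : ℝ) : ℂ)‖ := by
          calc ‖w‖ = ‖(w - z) + (z - (σ : ℂ)) + ((σ : ℝ) : ℂ)‖ := by congr 1; ring
            _ ≤ ‖(w - z) + (z - (σ : ℂ))‖ + ‖((σ : ℝ) : ℂ)‖ := norm_add_le _ _
            _ ≤ _ := by linarith [norm_add_le (w - z) (z - (σ : ℂ))]
        rw [Complex.norm_real, Real.norm_eq_abs] at h1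
        linarith)
    simpa using h
  have hconv : Convex ℝ (Metric.ball ((σ : ℝ) : ℂ) 1) := convex_ball _ _
  have hxs : ((x : ℝ) : ℂ) ∈ Metric.ball ((σ : ℝ) : ℂ) 1 := by
    rw [Metric.mem_ball, dist_eq_norm, ← Complex.ofReal_sub, Complex.norm_real, Real.norm_eq_abs]; exact hx
  have hσs : ((σ : ℝ) : ℂ) ∈ Metric.ball ((σ : ℝ) : ℂ) 1 := Metric.mem_ball_self one_pos
  have := hconv.norm_image_sub_le_of_norm_deriv_le (fun z _ => hdiff.differentiableAt) hderiv hσs hxs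
  rw [Frel₂_eq_FrelC, Frel₂_eq_FrelC]
  refine this.trans (le_of_eq ?_)
  rw [← Complex.ofReal_sub, Complex.norm_real, Real.norm_eq_abs]

end Lipschitz

/-! ## §2 Root avoidance by the rational-root bound -/

section RootAvoidance

/-- **ROOT AVOIDANCE.** A fibre sum `Σ_{s ∈ S} c_s r^{s₂}` over a set `S` of monomials of `P` on which `s ↦ s 2` is
injective does not vanish at any rational `r` in lowest terms whose denominator exceeds `mvlen P`
(clear denominators and reduce modulo `den r`: the top term `c_{s*} num^{N}` would be divisible by `den r`,
forcing `den r ≤ |c_{s*}| ≤ mvlen P`). Replaces g44b's existential punctured ball. -/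
theorem fibreSum_ne_zero {N : ℕ} (P : MvPolynomial (Fin N) ℤ) (e : (Fin N →₀ ℕ) → ℕ) (S : Finset (Fin N →₀ ℕ))
    (hS : S ⊆ P.support) (hinj : ∀ s ∈ S, ∀ s' ∈ S, e s = e s' → s = s') (hne : S.Nonempty)
    (r : ℚ) (hden : mvlen P < (r.den : ℤ)) :
    ∑ s ∈ S, ((P.coeff s : ℤ) : ℂ) * (((r : ℝ) : ℂ)) ^ (e s) ≠ 0 := by
  classical
  -- the top exponent and the unique monomial carrying it
  obtain ⟨s₁, hs₁, hmax⟩ := S.exists_max_image e hne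
  set M := e s₁ with hM
  set q : ℤ := (r.den : ℤ) with hqdef
  set a : ℤ := r.num with hadef
  have hq0 : (0 : ℤ) < q := by rw [hqdef]; exact_mod_cast r.pos
  have hqC : (q : ℂ) ≠ 0 := by exact_mod_cast hq0.ne'
  -- the integer Z = Σ c_s a^{e s} q^{M - e s} and the identity  (sum) · q^M = Z
  set Z : ℤ := ∑ s ∈ S, P.coeff s * a ^ (e s) * q ^ (M - e s) with hZ
  have hrC : ((r : ℚ) : ℂ) = (a : ℂ) / (q : ℂ) := by
    rw [hadef, hqdef]
    push_cast
    exact Rat.cast_def r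
  have hid : (∑ s ∈ S, ((P.coeff s : ℤ) : ℂ) * (((r : ℝ) : ℂ)) ^ (e s)) * (q : ℂ) ^ M = (Z : ℂ) := by
    rw [hZ, Finset.sum_mul, Complex.ofReal_ratCast]
    push_cast
    refine Finset.sum_congr rfl fun s hs => ?_
    have hle : e s ≤ M := hmax s hs
    rw [hrC, div_pow, ← pow_sub_mul_pow (q : ℂ) hle]
    field_simp
  intro h0
  have hZ0 : Z = 0 := by
    have : ((Z : ℤ) : ℂ) = 0 := by rw [← hid, h0, zero_mul]
    exact_mod_cast this
  -- reduce modulo q: every term with e s < M is divisible by q, so q ∣ c_{s₁} a^M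
  have hdvd : q ∣ P.coeff s₁ * a ^ M := by
    have hsplit : Z = P.coeff s₁ * a ^ M + ∑ s ∈ S.erase s₁, P.coeff s * a ^ (e s) * q ^ (M - e s) := by
      rw [hZ, ← Finset.add_sum_erase S _ hs₁, ← hM, Nat.sub_self, pow_zero, mul_one]
    have hrest : q ∣ ∑ s ∈ S.erase s₁, P.coeff s * a ^ (e s) * q ^ (M - e s) := by
      refine Finset.dvd_sum fun s hs => ?_
      have hsS : s ∈ S := Finset.mem_of_mem_erase hs
      have hne' : s ≠ s₁ := Finset.ne_of_mem_erase hs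
      have hlt : e s < M := lt_of_le_of_ne (hmax s hsS) fun h => hne' (hinj s hsS s₁ hs₁ (h.trans hM.symm))
      rw [show M - e s = (M - e s - 1) + 1 by omega, pow_succ]
      exact (dvd_mul_left q _).mul_left _
    have : P.coeff s₁ * a ^ M = Z - ∑ s ∈ S.erase s₁, P.coeff s * a ^ (e s) * q ^ (M - e s) := by
      rw [hsplit]; ring
    rw [this, hZ0, zero_sub]
    exact (dvd_neg).2 hrest
  -- gcd(a, q) = 1, so q ∣ c_{s₁}, whence q ≤ |c_{s₁}| ≤ mvlen P < q
  have hcop : IsCoprime q (a ^ M) := by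
    refine IsCoprime.pow_right ?_
    rw [Int.isCoprime_iff_gcd_eq_one, hqdef, hadef, Int.gcd_comm]
    exact r.reduced
  have hdvd' : q ∣ P.coeff s₁ := hcop.dvd_of_dvd_mul_right hdvd
  have hc0 : P.coeff s₁ ≠ 0 := MvPolynomial.mem_support_iff.1 (hS hs₁)
  have hle : q ≤ |P.coeff s₁| := Int.le_of_dvd (abs_pos.2 hc0) ((dvd_abs _ _).2 hdvd')
  have := abs_coeff_le_mvlen P s₁
  omega

end RootAvoidance

end Summit.Schanuel.Schanuel.Theorems.RootDecomp1BProductCell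

end
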